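import Mathlib.Probability.Process.Stopping
import Mathlib.MeasureTheory.Function.Floor
import Mathlib.MeasureTheory.Constructions.BorelSpace.Metrizable
import Literature.Probability.Process.StoppedMartingale
import HarnessLib

/-!
# Adapted processes with right-continuous paths are progressively measurable

Topic `Probability/Process`. For a real process `g : ℝ≥0 → Ω → ℝ` adapted to a filtration `𝓕`
(raw, no usual conditions) whose every path is **right-continuous**
(`ContinuousWithinAt (g · ω) (Set.Ici t) t` for all `t`), we prove that `g` is (strongly)
progressively measurable (`Literature.Probability.Process.isStronglyProgressive_of_rightContinuous`).
This is the classical statement of Karatzas–Shreve, Prop. 1.1.13 / Revuz–Yor, Ch. I, Prop. (4.8)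
("a right-continuous adapted process is progressively measurable"); Mathlib has the
continuous-path case (`MeasureTheory.StronglyAdapted.isStronglyProgressive_of_continuous`), and
the tree has the left-regularisation device `Literature.Analysis.FunctionSpaces.dyadicReg`
(`isStronglyProgressive_dyadicReg`); the right-continuous case is needed for processes such as
the Loewner flow `t ↦ gₜ(z)` read with its junk value after the swallowing time (continuous
before `T_z`, constant from `T_z` on).

Proof: on `[0, i] × Ω` the process is the pointwise limit of the dyadic *upper* approximations
`(t, ω) ↦ g(min i ((⌊2ⁿt⌋ + 1)/2ⁿ), ω)` (right-continuity; the approximating times lie in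
`(t, t + 2⁻ⁿ] ∩ [0, i]`; `Literature.Probability.Process.dyadicCeil` of `StoppedMartingale.lean`),
each of which factors measurably through the countable product `ℕ × Ω` with the `σ`-algebra
`𝓕 i` on the second factor (adaptedness at the times `min i (k/2ⁿ) ≤ i`).

## References

* I. Karatzas, S. Shreve, *Brownian Motion and Stochastic Calculus* (2nd ed., 1991), Ch. 1,
  Prop. 1.13.
* D. Revuz, M. Yor, *Continuous Martingales and Brownian Motion* (3rd ed., 1999), Ch. I,
  Prop. (4.8).
-/

noncomputable section

open MeasureTheory Filter Set
open scoped NNReal Topology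

namespace Literature.Probability.Process

variable {Ω : Type*} {m : MeasurableSpace Ω}

/-! ### Right limits along the dyadic upper approximations -/

/-- Along a right-continuous path, the values at the capped dyadic upper approximations
`min i ((⌊2ⁿt⌋ + 1)/2ⁿ)` converge to the value at `t ≤ i`. [folklore] -/
theorem tendsto_apply_min_dyadicCeil {g : ℝ≥0 → ℝ} {t i : ℝ≥0} (hti : t ≤ i)
    (hc : ContinuousWithinAt g (Set.Ici t) t) :
    Tendsto (fun n ↦ g (min i (dyadicCeil n t))) atTop (𝓝 (g t)) := by
  have h1 : Tendsto (fun n ↦ min i (dyadicCeil n t)) atTop (𝓝 t) := by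
    have := (tendsto_const_nhds (x := i)).min (tendsto_dyadicCeil t)
    rwa [min_eq_right hti] at this
  have h2 : Tendsto (fun n ↦ min i (dyadicCeil n t)) atTop (𝓝[Set.Ici t] t) :=
    tendsto_nhdsWithin_of_tendsto_nhds_of_eventually_within _ h1
      (Eventually.of_forall fun n ↦ le_min hti (lt_dyadicCeil n t).le)
  exact hc.tendsto.comp h2

/-! ### Right-continuous adapted processes are progressive -/

/-- **A right-continuous adapted real process is (strongly) progressively measurable.** If
`g : ℝ≥0 → Ω → ℝ` is adapted to the filtration `𝓕` and every path `t ↦ g t ω` is right-continuous,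
then `g` is strongly progressively measurable with respect to `𝓕`.
Karatzas–Shreve (1991), Ch. 1, Prop. 1.13; Revuz–Yor (1999), Ch. I, Prop. (4.8). [folklore] -/
theorem isStronglyProgressive_of_rightContinuous {𝓕 : Filtration ℝ≥0 m} {g : ℝ≥0 → Ω → ℝ}
    (hg : Adapted 𝓕 g) (hc : ∀ ω t, ContinuousWithinAt (g · ω) (Set.Ici t) t) :
    IsStronglyProgressive 𝓕 g := by
  intro i
  -- each dyadic upper approximation factors through `ℕ × Ω`
  have hn : ∀ n : ℕ, Measurable[MeasurableSpace.prod Subtype.instMeasurableSpace (𝓕 i)]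
      fun p : Set.Iic i × Ω ↦ g (min i (dyadicCeil n p.1)) p.2 := by
    intro n
    let Ψ : ℕ × Ω → ℝ := fun q ↦ g (min i ((q.1 : ℝ≥0) / 2 ^ n)) q.2
    have hΨ : Measurable[MeasurableSpace.prod Nat.instMeasurableSpace (𝓕 i)] Ψ := by
      refine @measurable_from_prod_countable_right ℕ Ω ℝ _ (𝓕 i) _ _ _ Ψ fun k ↦ ?_
      exact (hg (min i ((k : ℝ≥0) / 2 ^ n))).mono (𝓕.mono (min_le_left _ _)) le_rfl
    let Φ : Set.Iic i × Ω → ℕ × Ω := fun p ↦ (⌊(p.1 : ℝ≥0) * 2 ^ n⌋₊ + 1, p.2)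
    have hΦ1 : Measurable[MeasurableSpace.prod Subtype.instMeasurableSpace (𝓕 i)]
        fun p : Set.Iic i × Ω ↦ ⌊(p.1 : ℝ≥0) * 2 ^ n⌋₊ + 1 :=
      ((measurable_subtype_coe.mul_const _).nat_floor.add_const 1).comp
        (@measurable_fst _ _ _ (𝓕 i))
    have hΦ2 : @Measurable (Set.Iic i × Ω) Ω
        (MeasurableSpace.prod Subtype.instMeasurableSpace (𝓕 i)) (𝓕 i) fun p ↦ p.2 :=
      @measurable_snd _ _ _ (𝓕 i)
    have hΦ : @Measurable (Set.Iic i × Ω) (ℕ × Ω)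
        (MeasurableSpace.prod Subtype.instMeasurableSpace (𝓕 i))
        (MeasurableSpace.prod Nat.instMeasurableSpace (𝓕 i)) Φ := hΦ1.prodMk hΦ2
    have heq : (fun p : Set.Iic i × Ω ↦ g (min i (dyadicCeil n p.1)) p.2) = Ψ ∘ Φ := by
      funext p
      simp only [Function.comp_apply, Ψ, Φ, dyadicCeil]
    rw [heq]
    exact hΨ.comp hΦ
  -- and they converge pointwise to `g` by right-continuity, so `g` is their `limUnder`
  have key : (fun p : Set.Iic i × Ω ↦ g p.1 p.2) =
      fun p ↦ limUnder atTop (fun n ↦ g (min i (dyadicCeil n p.1)) p.2) := by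
    funext p
    exact ((tendsto_apply_min_dyadicCeil p.1.2 (hc p.2 p.1)).limUnder_eq).symm
  rw [key]
  exact @StronglyMeasurable.limUnder ℕ (Set.Iic i × Ω) ℝ
    (MeasurableSpace.prod Subtype.instMeasurableSpace (𝓕 i)) _ _ atTop _
    (fun n p ↦ g (min i (dyadicCeil n p.1)) p.2) _ _ fun n ↦ (hn n).stronglyMeasurable

/-- A right-continuous adapted real process is progressively measurable; version with the
hypothesis phrased on `{s | t ≤ s}`-restricted continuity of each path at each time, and
conclusion the strong adaptedness of the process stopped at a stopping time (Mathlib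
`IsStronglyProgressive.stronglyAdapted_stoppedProcess`). [folklore] -/
theorem stronglyAdapted_stoppedProcess_of_rightContinuous {𝓕 : Filtration ℝ≥0 m}
    {g : ℝ≥0 → Ω → ℝ} (hg : Adapted 𝓕 g) (hc : ∀ ω t, ContinuousWithinAt (g · ω) (Set.Ici t) t)
    {τ : Ω → WithTop ℝ≥0} (hτ : IsStoppingTime 𝓕 τ) :
    StronglyAdapted 𝓕 (stoppedProcess g τ) :=
  (isStronglyProgressive_of_rightContinuous hg hc).stronglyAdapted_stoppedProcess hτ

end Literature.Probability.Process
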